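import Summits.AtomisticToContinuum.HydrodynamicLimit.Theorems.RelayRaceLocalityNearConstantShortTimeHLGeneralGibbs
import Summits.AtomisticToContinuum.HydrodynamicLimit.Theorems.RelayRaceLocalityNearConstantShortTimeHLTorusCells
import Summits.AtomisticToContinuum.HydrodynamicLimit.Theorems.RelayRaceLocalityNearConstantShortTimeHLPiLemmas
import Literature.MathematicalPhysics.KineticTheory.HardSphereCanonicalTorus
import HarnessLib

/-!
# Crux `NearConstantShortTimeHL` (stmt-AtomisticToContinuum-12502), line `small-tilt-domination` — THE CHESSBOARD ESTIMATE
(abstract form; steps 2–4 of the conditional Gaussian estimate `stub_velocityLD`)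

* `lintegral_exp_mul_setAverage_le` — the cell step: for a probability law `P`, a measurable cell `c ⊆ 𝕋³` of positive Haar volume and
  a nonnegative jointly measurable integrand `g y ω` (bounded in `y` for each `ω`), a per-centre exponential-moment bound
  `∫⁻ exp(s g(y,·)) dP ≤ b` on `c` gives the same bound for the cell average, `∫⁻ exp(s ⨍_c g(y,·) dy) dP ≤ b` (Jensen + Tonelli);
* `chessboard_lintegral_exp_le` (registered) — velocities independent given the positions (`Measure.pi`), cells of mesh `1/k` (`k` even,
  `2ℓ ≤ 1/k`), an integrand depending on the velocities of the particles within `ℓ` of the centre only, and a per-centre bound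
  `≤ B exp(C #(T ∩ ball))`: then `∫⁻ exp((s k³/8) ∫ g dy) ≤ (B^{k³} exp(27 C #T))^{1/8}` — split over the `k³` cells, group into 8 colour
  classes, Hölder over the colours, independence of same-colour cells (`torus_cells_separation` + `lintegral_prod_eq_prod_of_dependsOn_disjoint`),
  the cell step, and the counting `Σ_cells #(T ∩ nbhd) ≤ 27 #T` (`torus_cells_locality`).

References: H.-T. Yau, Lett. Math. Phys. 22 (1991) §2 (chessboard estimates of the relative-entropy method).
-/

noncomputable section

namespace Summit.AtomisticToContinuum.HydrodynamicLimit.Theorems.NearConstantShortTimeHL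

open scoped BigOperators ENNReal
open MeasureTheory Set Filter
open Literature.MathematicalPhysics.KineticTheory Literature.Analysis.FluidPDE Literature.Analysis.FunctionSpaces

/-- A jointly measurable integrand, integrated in its first (torus) variable over a set, is measurable in the second
variable. [folklore] -/
theorem measurable_setIntegral_left {Ω : Type*} [MeasurableSpace Ω] {g : T3 → Ω → ℝ}
    (hgm : Measurable (Function.uncurry g)) (c : Set T3) :
    Measurable fun ω => ∫ y in c, g y ω := by
  have h : StronglyMeasurable (Function.uncurry fun (ω : Ω) (y : T3) => g y ω) :=
    (hgm.comp measurable_swap).stronglyMeasurable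
  exact (h.integral_prod_right' (ν := (volume : Measure T3).restrict c)).measurable

/-- **Cell step of the chessboard estimate (Jensen + Tonelli).** For a probability law `P`, a measurable cell `c ⊆ 𝕋³`
with `volume c ≠ 0`, a nonnegative jointly measurable `g` bounded in the centre for each sample, and `0 ≤ s`: if
`∫⁻ exp(s g(y,·)) dP ≤ b` for every `y ∈ c`, then `∫⁻ exp(s (volume c)⁻¹ ∫_c g(y,·) dy) dP ≤ b`. [cite: Yau1991, §2] -/
theorem lintegral_exp_mul_setAverage_le {Ω : Type*} [MeasurableSpace Ω] (P : Measure Ω) [IsProbabilityMeasure P]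
    {c : Set T3} (hc : MeasurableSet c) (hc0 : volume c ≠ 0)
    (g : T3 → Ω → ℝ) (hg0 : ∀ y ω, 0 ≤ g y ω) (hgm : Measurable (Function.uncurry g))
    (hgb : ∀ ω, ∃ C, ∀ y, g y ω ≤ C) {s : ℝ} (hs : 0 ≤ s) {b : ℝ≥0∞}
    (hbound : ∀ y ∈ c, ∫⁻ ω, ENNReal.ofReal (Real.exp (s * g y ω)) ∂P ≤ b) :
    ∫⁻ ω, ENNReal.ofReal (Real.exp (s * (volume.real c)⁻¹ * ∫ y in c, g y ω)) ∂P ≤ b := by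
  have hcT : volume c ≠ ∞ := measure_ne_top _ _
  have hcpos : 0 < volume.real c := ENNReal.toReal_pos hc0 hcT
  -- sections of `g` are measurable
  have hgy : ∀ ω, Measurable fun y => g y ω := fun ω => hgm.comp (measurable_id.prodMk measurable_const)
  -- pointwise Jensen
  have hJ : ∀ ω, ENNReal.ofReal (Real.exp (s * (volume.real c)⁻¹ * ∫ y in c, g y ω)) ≤
      (volume c)⁻¹ * ∫⁻ y in c, ENNReal.ofReal (Real.exp (s * g y ω)) := by
    intro ω
    obtain ⟨C, hC⟩ := hgb ω
    have hfi : IntegrableOn (fun y => s * g y ω) c volume := by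
      refine ((integrable_const (s * max C 0)).mono' ((hgy ω).const_mul s).aestronglyMeasurable
        (ae_of_all _ fun y => ?_)).integrableOn
      rw [Real.norm_eq_abs, abs_of_nonneg (mul_nonneg hs (hg0 y ω))]
      exact mul_le_mul_of_nonneg_left ((hC y).trans (le_max_left _ _)) hs
    have hgi : IntegrableOn (Real.exp ∘ fun y => s * g y ω) c volume := by
      refine ((integrable_const (Real.exp (s * max C 0))).mono'
        (((hgy ω).const_mul s).exp).aestronglyMeasurable (ae_of_all _ fun y => ?_)).integrableOn
      rw [Real.norm_eq_abs, abs_of_nonneg (Real.exp_pos _).le]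
      exact Real.exp_le_exp.2 (mul_le_mul_of_nonneg_left ((hC y).trans (le_max_left _ _)) hs)
    have key := (convexOn_exp).map_set_average_le (μ := (volume : Measure T3)) (t := c)
      (f := fun y => s * g y ω) Real.continuous_exp.continuousOn isClosed_univ hc0 hcT
      (ae_of_all _ fun y => mem_univ _) hfi hgi
    -- rewrite the averages
    have hA : ⨍ y in c, s * g y ω = s * (volume.real c)⁻¹ * ∫ y in c, g y ω := by
      rw [setAverage_eq, integral_const_mul, smul_eq_mul]
      ring
    have hB : ⨍ y in c, Real.exp (s * g y ω) = (volume.real c)⁻¹ * ∫ y in c, Real.exp (s * g y ω) := by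
      rw [setAverage_eq, smul_eq_mul]
    rw [hA, hB] at key
    have hI : ENNReal.ofReal (∫ y in c, Real.exp (s * g y ω)) = ∫⁻ y in c, ENNReal.ofReal (Real.exp (s * g y ω)) :=
      ofReal_integral_eq_lintegral_ofReal hgi (ae_of_all _ fun y => (Real.exp_pos _).le)
    calc ENNReal.ofReal (Real.exp (s * (volume.real c)⁻¹ * ∫ y in c, g y ω))
        ≤ ENNReal.ofReal ((volume.real c)⁻¹ * ∫ y in c, Real.exp (s * g y ω)) := ENNReal.ofReal_le_ofReal key
      _ = (volume c)⁻¹ * ∫⁻ y in c, ENNReal.ofReal (Real.exp (s * g y ω)) := by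
          rw [ENNReal.ofReal_mul (inv_nonneg.2 hcpos.le), hI, measureReal_def,
            ENNReal.ofReal_inv_of_pos (ENNReal.toReal_pos hc0 hcT), ENNReal.ofReal_toReal hcT]
  -- integrate and swap
  have hF : AEMeasurable (Function.uncurry fun (ω : Ω) (y : T3) => ENNReal.ofReal (Real.exp (s * g y ω)))
      (P.prod (volume.restrict c)) :=
    ((hgm.comp measurable_swap).const_mul s).exp.ennreal_ofReal.aemeasurable
  calc ∫⁻ ω, ENNReal.ofReal (Real.exp (s * (volume.real c)⁻¹ * ∫ y in c, g y ω)) ∂P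
      ≤ ∫⁻ ω, (volume c)⁻¹ * (∫⁻ y in c, ENNReal.ofReal (Real.exp (s * g y ω))) ∂P := lintegral_mono hJ
    _ = (volume c)⁻¹ * ∫⁻ y in c, (∫⁻ ω, ENNReal.ofReal (Real.exp (s * g y ω)) ∂P) := by
        rw [lintegral_const_mul' _ _ (ENNReal.inv_ne_top.2 hc0), lintegral_lintegral_swap hF]
    _ ≤ (volume c)⁻¹ * ∫⁻ _y in c, b := by
        gcongr 1
        exact lintegral_mono_ae ((ae_restrict_iff' hc).2 (ae_of_all _ hbound))
    _ = b := by
        rw [setLIntegral_const, mul_comm b, ← mul_assoc, ENNReal.inv_mul_cancel hc0 hcT, one_mul]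


/-! ## The chessboard estimate -/

/-- The colour (parity vector) of a cell index. [folklore] -/
def cellColour {k : ℕ} (j : Fin 3 → Fin k) : Fin 3 → Fin 2 := fun i => ⟨(j i : ℕ) % 2, Nat.mod_lt _ two_pos⟩

/-- Two cell indices have the same colour iff their coordinates have the same parities. [folklore] -/
theorem cellColour_eq_iff {k : ℕ} (j j' : Fin 3 → Fin k) :
    cellColour j = cellColour j' ↔ ∀ i, (j i : ℕ) % 2 = (j' i : ℕ) % 2 := by
  simp only [cellColour, funext_iff, Fin.mk.injEq]

/-- **THE CHESSBOARD ESTIMATE (abstract form).** Velocities independent given the positions (`Measure.pi μ`,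
probability marginals); cells of mesh `1/k` (`k` even) with `2ℓ ≤ 1/k`; a nonnegative jointly measurable integrand `g y v`,
bounded in `y` for each `v`, depending on `v` only through the particles within minimal-image distance `ℓ` of `y`; a
per-centre exponential-moment bound `∫⁻ exp(s g(y,·)) ≤ B exp(C · #(T ∩ ball(y)))` for a fixed set `T` of (crowded)
particles. Then `∫⁻ exp((s k³/8) ∫ g(y,·) dy) ≤ (B^{k³} exp(27 C #T))^{1/8}`: split `∫ g = Σ_cells`, group the `k³` cells
into 8 colour classes, Hölder over the colours, independence of same-colour cells (their `ℓ`-neighbourhoods are disjoint by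
`torus_cells_separation`), Jensen + Tonelli on each cell (`lintegral_exp_mul_setAverage_le`), and `Σ_cells #(T ∩ nbhd) ≤
27 #T` (`torus_cells_locality`). [cite: Yau1991, §2] -/
theorem chessboard_lintegral_exp_le : ∀ {m : ℕ} (μ : Fin m → Measure V3) [∀ i, IsProbabilityMeasure (μ i)] {k : ℕ}, 0 < k → Even k → ∀ {ℓ : ℝ}, 2 * ℓ ≤ (k : ℝ)⁻¹ → ∀ (x : Fin m → T3) (g : T3 → (Fin m → V3) → ℝ), (∀ y v, 0 ≤ g y v) → Measurable (Function.uncurry g) → (∀ v, ∃ C, ∀ y, g y v ≤ C) → (∀ y v w, (∀ i, Torus.euclidDist y (x i) < ℓ → v i = w i) → g y v = g y w) → ∀ {s B Ccr : ℝ}, 0 ≤ s → 1 ≤ B → 0 ≤ Ccr → ∀ T : Finset (Fin m), (∀ y, ∫⁻ v, ENNReal.ofReal (Real.exp (s * g y v)) ∂Measure.pi μ ≤ ENNReal.ofReal (B * Real.exp (Ccr * ((T.filter fun i => Torus.euclidDist y (x i) < ℓ).card : ℝ)))) → ∫⁻ v, ENNReal.ofReal (Real.exp (s * (k : ℝ)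 ^ 3 / 8 * ∫ y, g y v)) ∂Measure.pi μ ≤ ENNReal.ofReal ((B ^ (k ^ 3) * Real.exp (27 * Ccr * T.card)) ^ (1 / 8 : ℝ)) := by
  intro m μ _ k hk hke ℓ hℓk x g hg0 hgm hgb hdep s B Ccr hs hB hC T hbound
  classical
  -- notation
  set cell : (Fin 3 → Fin k) → Set T3 := fun j => {y : T3 | Torus.gridIndex k (Torus.repr y) = Torus.finIndex j}
    with hcell
  have hcm : ∀ j, MeasurableSet (cell j) := fun j => measurableSet_cell hk j
  have hkpos : (0 : ℝ) < k := by exact_mod_cast hk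
  have hvol : ∀ j, volume (cell j) = ((k : ℝ≥0∞)⁻¹) ^ 3 := fun j => volume_cell hk j
  have hvol0 : ∀ j, volume (cell j) ≠ 0 := fun j => by
    rw [hvol]; exact pow_ne_zero _ (ENNReal.inv_ne_zero.2 (ENNReal.natCast_ne_top k))
  have hvolR : ∀ j, volume.real (cell j) = ((k : ℝ) ^ 3)⁻¹ := fun j => by
    rw [measureReal_def, hvol, ENNReal.toReal_pow, ENNReal.toReal_inv, ENNReal.toReal_natCast, inv_pow]
  -- the cell functionals
  set G : (Fin 3 → Fin k) → (Fin m → V3) → ℝ := fun j v => ∫ y in cell j, g y v with hG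
  -- neighbourhoods of the cells
  set I : (Fin 3 → Fin k) → Finset (Fin m) := fun j => Finset.univ.filter fun i => ∃ y ∈ cell j, Torus.euclidDist y (x i) < ℓ
    with hI
  set n : (Fin 3 → Fin k) → ℕ := fun j => (T.filter fun i => ∃ y ∈ cell j, Torus.euclidDist y (x i) < ℓ).card with hn
  set t : ℝ := s * (k : ℝ) ^ 3 / 8 with ht
  have ht0 : 0 ≤ t := by positivity
  have h8t : 8 * t = s * (volume.real (cell (fun _ => ⟨0, hk⟩)))⁻¹ := by rw [hvolR, inv_inv, ht]; ring
  -- Step 1: the integral splits over the cells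
  have hgy : ∀ v, Measurable fun y => g y v := fun v => hgm.comp (measurable_id.prodMk measurable_const)
  have hint : ∀ v, Integrable (fun y => g y v) := fun v => by
    obtain ⟨C, hC⟩ := hgb v
    refine (integrable_const (max C 0)).mono' (hgy v).aestronglyMeasurable (ae_of_all _ fun y => ?_)
    rw [Real.norm_eq_abs, abs_of_nonneg (hg0 y v)]
    exact (hC y).trans (le_max_left _ _)
  have hsplit : ∀ v, ∫ y, g y v = ∑ j, G j v := fun v => by
    have h := integral_iUnion_fintype hcm (pairwise_disjoint_cell (k := k)) (fun j => (hint v).integrableOn)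
    rwa [iUnion_cell_eq_univ hk, setIntegral_univ] at h
  -- Step 2: regroup by colour
  have hcol : ∀ v, ∑ j, G j v = ∑ p : Fin 3 → Fin 2, ∑ j ∈ Finset.univ.filter (fun j => cellColour j = p), G j v :=
    fun v => (Finset.sum_fiberwise Finset.univ cellColour fun j => G j v).symm
  -- the colour functionals and Hölder
  set X : (Fin 3 → Fin 2) → (Fin m → V3) → ℝ := fun p v => ∑ j ∈ Finset.univ.filter (fun j => cellColour j = p), G j v
    with hX
  have hGm : ∀ j, Measurable (G j) := fun j => measurable_setIntegral_left hgm (cell j)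
  have hXm : ∀ p, Measurable (X p) := fun p => Finset.measurable_sum _ fun j _ => hGm j
  set f : (Fin 3 → Fin 2) → (Fin m → V3) → ℝ≥0∞ := fun p v => ENNReal.ofReal (Real.exp (8 * t * X p v)) with hf
  have hfm : ∀ p, Measurable (f p) := fun p => ((hXm p).const_mul _).exp.ennreal_ofReal
  have hlhs : ∀ v, ENNReal.ofReal (Real.exp (t * ∫ y, g y v)) = ∏ p, f p v ^ (1 / 8 : ℝ) := fun v => by
    rw [hsplit, hcol, Finset.mul_sum, Real.exp_sum, ENNReal.ofReal_prod_of_nonneg (fun p _ => (Real.exp_pos _).le)]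
    refine Finset.prod_congr rfl fun p _ => ?_
    simp only [hf, hX]
    rw [ENNReal.ofReal_rpow_of_nonneg (Real.exp_pos _).le (by norm_num), ← Real.exp_mul]
    congr 1
    ring_nf
  have hHolder : ∫⁻ v, ∏ p, f p v ^ (1 / 8 : ℝ) ∂Measure.pi μ ≤ ∏ p, (∫⁻ v, f p v ∂Measure.pi μ) ^ (1 / 8 : ℝ) := by
    refine ENNReal.lintegral_prod_norm_pow_le Finset.univ (fun p _ => (hfm p).aemeasurable) ?_ (fun p _ => by norm_num)
    rw [Finset.sum_const, Finset.card_univ, Fintype.card_fun, Fintype.card_fin, Fintype.card_fin]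
    norm_num
  -- Step 3: independence of same-colour cells
  have hIdisj : ∀ p, ∀ a ∈ Finset.univ.filter (fun j => cellColour j = p), ∀ b ∈ Finset.univ.filter (fun j => cellColour j = p),
      a ≠ b → Disjoint (I a) (I b) := by
    intro p a ha b hb hab
    rw [Finset.mem_filter] at ha hb
    have hpar : ∀ i, (a i : ℕ) % 2 = (b i : ℕ) % 2 := (cellColour_eq_iff a b).1 (ha.2.trans hb.2.symm)
    rw [Finset.disjoint_left]
    intro i hia hib
    simp only [hI, Finset.mem_filter, Finset.mem_univ, true_and] at hia hib
    obtain ⟨y, hy, hyi⟩ := hia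
    obtain ⟨y', hy', hy'i⟩ := hib
    have hsep := torus_cells_separation k hk hke a b hab hpar y y' hy hy'
    have htri : Torus.euclidDist y y' ≤ Torus.euclidDist y (x i) + Torus.euclidDist (x i) y' :=
      Literature.MathematicalPhysics.KineticTheory.euclidDist_triangle y (x i) y'
    rw [Torus.euclidDist_comm (x i) y'] at htri
    linarith
  have hFdep : ∀ j (v w : Fin m → V3), (∀ i ∈ I j, v i = w i) → G j v = G j w := by
    intro j v w hvw
    simp only [hG]
    refine setIntegral_congr_fun (hcm j) fun y hy => hdep y v w fun i hi => hvw i ?_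
    simp only [hI, Finset.mem_filter, Finset.mem_univ, true_and]
    exact ⟨y, hy, hi⟩
  have hindep : ∀ p, ∫⁻ v, f p v ∂Measure.pi μ =
      ∏ j ∈ Finset.univ.filter (fun j => cellColour j = p), ∫⁻ v, ENNReal.ofReal (Real.exp (8 * t * G j v)) ∂Measure.pi μ := by
    intro p
    have h := lintegral_prod_eq_prod_of_dependsOn_disjoint μ (Finset.univ.filter fun j => cellColour j = p) I (hIdisj p)
      (fun j v => ENNReal.ofReal (Real.exp (8 * t * G j v))) (fun j _ => ((hGm j).const_mul _).exp.ennreal_ofReal)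
      (fun j _ v w hvw => by simp only [hFdep j v w hvw])
    rw [← h]
    refine lintegral_congr fun v => ?_
    simp only [hf, hX, Finset.mul_sum, Real.exp_sum]
    rw [ENNReal.ofReal_prod_of_nonneg fun j _ => (Real.exp_pos _).le]
  -- Step 4: the cell bound (Jensen + Tonelli)
  have hcellb : ∀ j, ∫⁻ v, ENNReal.ofReal (Real.exp (8 * t * G j v)) ∂Measure.pi μ ≤
      ENNReal.ofReal (B * Real.exp (Ccr * n j)) := by
    intro j
    have hvj : volume.real (cell j) = volume.real (cell (fun _ => ⟨0, hk⟩)) := by rw [hvolR, hvolR]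
    have key := lintegral_exp_mul_setAverage_le (Measure.pi μ) (hcm j) (hvol0 j) g hg0 hgm hgb hs
      (b := ENNReal.ofReal (B * Real.exp (Ccr * n j))) (fun y hy => (hbound y).trans ?_)
    · simpa only [hG, h8t, ← hvj, mul_assoc] using key
    · refine ENNReal.ofReal_le_ofReal (mul_le_mul_of_nonneg_left (Real.exp_le_exp.2
        (mul_le_mul_of_nonneg_left ?_ hC)) (by linarith))
      refine Nat.cast_le.2 (Finset.card_le_card fun i hi => ?_)
      rw [Finset.mem_filter] at hi ⊢
      exact ⟨hi.1, y, hy, hi.2⟩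
  -- Step 5: counting
  have hcount : (∑ j, (n j : ℝ)) ≤ 27 * T.card := by
    have h1 : ∀ j, (n j : ℝ) = ∑ i ∈ T, if (∃ y ∈ cell j, Torus.euclidDist y (x i) < ℓ) then (1 : ℝ) else 0 := fun j => by
      simp only [hn, Finset.card_filter, Nat.cast_sum, Nat.cast_ite, Nat.cast_one, Nat.cast_zero]
    simp_rw [h1]
    rw [Finset.sum_comm]
    have h2 : ∀ i ∈ T, (∑ j : Fin 3 → Fin k, if (∃ y ∈ cell j, Torus.euclidDist y (x i) < ℓ) then (1 : ℝ) else 0) ≤ 27 := by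
      intro i _
      rw [Finset.sum_boole]
      have hℓ' : ℓ ≤ 1 / (2 * k) := by
        rw [le_div_iff₀ (by positivity)]
        have := mul_le_mul_of_nonneg_right hℓk hkpos.le
        rw [inv_mul_cancel₀ hkpos.ne'] at this
        linarith
      have := torus_cells_locality k hk ℓ hℓ' (x i) (Finset.univ.filter fun j => ∃ y ∈ cell j, Torus.euclidDist y (x i) < ℓ)
        (fun j hj => by
          simp only [Finset.mem_filter, Finset.mem_univ, true_and] at hj
          obtain ⟨y, hy, hyi⟩ := hj
          exact ⟨y, hy, hyi⟩)
      exact_mod_cast this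
    calc (∑ i ∈ T, ∑ j : Fin 3 → Fin k, if (∃ y ∈ cell j, Torus.euclidDist y (x i) < ℓ) then (1 : ℝ) else 0)
        ≤ ∑ _i ∈ T, (27 : ℝ) := Finset.sum_le_sum h2
      _ = 27 * T.card := by rw [Finset.sum_const, nsmul_eq_mul, mul_comm]
  -- Step 6: assemble
  have hcard : (Finset.univ : Finset (Fin 3 → Fin k)).card = k ^ 3 := by simp [Finset.card_univ, Fintype.card_fin]
  calc ∫⁻ v, ENNReal.ofReal (Real.exp (t * ∫ y, g y v)) ∂Measure.pi μ
      = ∫⁻ v, ∏ p, f p v ^ (1 / 8 : ℝ) ∂Measure.pi μ := lintegral_congr hlhs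
    _ ≤ ∏ p, (∫⁻ v, f p v ∂Measure.pi μ) ^ (1 / 8 : ℝ) := hHolder
    _ ≤ ∏ p, (∏ j ∈ Finset.univ.filter (fun j => cellColour j = p), ENNReal.ofReal (B * Real.exp (Ccr * n j))) ^ (1 / 8 : ℝ) := by
        refine Finset.prod_le_prod (fun p _ => zero_le) fun p _ => ENNReal.rpow_le_rpow ?_ (by norm_num)
        rw [hindep]
        exact Finset.prod_le_prod (fun j _ => zero_le) fun j _ => hcellb j
    _ = ∏ j, ENNReal.ofReal (B * Real.exp (Ccr * n j)) ^ (1 / 8 : ℝ) := by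
        rw [← Finset.prod_fiberwise Finset.univ cellColour (fun j => ENNReal.ofReal (B * Real.exp (Ccr * n j)) ^ (1 / 8 : ℝ))]
        exact Finset.prod_congr rfl fun p _ => (ENNReal.prod_rpow_of_nonneg (by norm_num)).symm
    _ = ENNReal.ofReal ((B ^ (k ^ 3) * Real.exp (Ccr * ∑ j, (n j : ℝ))) ^ (1 / 8 : ℝ)) := by
        rw [ENNReal.prod_rpow_of_nonneg (by norm_num), ← ENNReal.ofReal_prod_of_nonneg (fun j _ => by positivity),
          Finset.prod_mul_distrib, Finset.prod_const, hcard, ← Real.exp_sum, ← Finset.mul_sum,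
          ENNReal.ofReal_rpow_of_nonneg (by positivity) (by norm_num)]
    _ ≤ ENNReal.ofReal ((B ^ (k ^ 3) * Real.exp (27 * Ccr * T.card)) ^ (1 / 8 : ℝ)) := by
        refine ENNReal.ofReal_le_ofReal (Real.rpow_le_rpow (by positivity) ?_ (by norm_num))
        refine mul_le_mul_of_nonneg_left (Real.exp_le_exp.2 ?_) (by positivity)
        calc Ccr * ∑ j, (n j : ℝ) ≤ Ccr * (27 * T.card) := mul_le_mul_of_nonneg_left hcount hC
          _ = 27 * Ccr * T.card := by ring

end Summit.AtomisticToContinuum.HydrodynamicLimit.Theorems.NearConstantShortTimeHL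

end
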